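import Summits.BirchSwinnertonDyer.BirchSwinnertonDyer.Theorems.TwoAdicConverseOrdLambdaHalfAtTwoGL1CycLineKLTriv
import Summits.BirchSwinnertonDyer.BirchSwinnertonDyer.Theorems.TwoAdicConverseOrdLambdaHalfAtTwoGreenbergTwistOrdinary
import Literature.NumberTheory.EllipticCurves.HeegnerPointsImaginaryQuadraticProofs
import Mathlib.NumberTheory.LegendreSymbol.JacobiSymbol
import HarnessLib

/-!
# The two Kubota–Leopoldt factors of the cyclotomic line at `2` for a Greenberg field `K = ℚ(√−D)`,
# `D ≡ 7 (mod 8)`: the depleted numerator `G⁺_{D,M,c}` of `L₂(s, ε_Kω)` and its TRIVIAL ZERO `T ∣ G⁺` (crux `OrdLambdaHalfAtTwo`, item stmt-BirchSwinnertonDyer-19556, line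
# `kato_determinant_greenberg_two`, v5 component D2 «cyc-line GL(1) analytic side at 2», pen RC-351 (3))

HONEST FRAMING.  Helper file (`--supports stmt-BirchSwinnertonDyer-19556 --as helper`); proves nothing about an
elliptic curve; BSD is not proved by any of this.  Companion of `…GL1CycLineKLNumerator` (the generic `2`-adic
numerator `G_{θ,c} = ∫_{ℤ₂^×}(1+T)^{ℓ(x)} d(θE_{1,c})(x)` of an odd `θ`).  Here `θ` is SPECIALISED to the two
characters of Gross's factorisation of the Katz `2`-adic `L`-function of `K` on the cyclotomic line,
`L^{Katz}_2(⟨N_K⟩^s) = L₂(ε_Kω, s) · ζ₂(1 − s)` (Gross, Invent. Math. 57 (1980); Kriz 2016 Thm. 28; applied at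
`p = 2` by Kriz–Li 2019 Lemma 7.6), each DEPLETED at the odd primes dividing an auxiliary odd modulus `M` (for the
line: `M = D·∏_{ℓ ∈ S} ℓ`, `S` = the bad primes of the curve, all split in `K`):

* `quadOddChar D M : ℤ/2M → ℤ₂`, `x ↦ ε_D(x)·𝟙[x unit]` with `ε_D = (·|D)` the Jacobi symbol — for `D ≡ 3 (4)`
  this is the odd quadratic character of `ℚ(√−D)` restricted to the classes prime to `2M` (`= ε_K·𝟙_odd·𝟙_S`);
  `quadTwoNumerator D M c = G⁺ = G_{ε_D𝟙_{(·,2M)=1}, c}` — by Lang Ch. 4 §3 Thm. 3.2 (PRINT) the numerator of the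
  `M`-depleted `L₂(−s, ε_Dω) = L₂(−s, χ_{−4·(−D)})`, the `2`-adic `L`-function of the EVEN character `ε_Kω` of
  the real quadratic field `ℚ(√D)`;
* (companion `…GL1CycLineKLTriv`) `trivTwoNumerator M c = G⁰`, the numerator of the `M`-depleted `2`-adic zeta
  function, `trivTwoNumerator 1 5 = klTwoNumerator`, `λ(½G⁰_{1,5}) = 0`, and the `λ`-handles `λ(T) = 1`, `λ(T·g) = 1 + λ(g)`.
* KERNEL: both `θ` are odd and vanish on the even classes, so (companion file) `½G⁺, ½G⁰ ∈ Λ`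
  (`halfLift`); **TRIVIAL ZERO** `constantCoeff_quadTwoNumerator_eq_zero` / `X_dvd_half_quadTwoNumerator`: for
  `D ≡ 7 (mod 8)` (i.e. `2` SPLIT in `ℚ(√−D)`: `ε_D(2) = (2|D) = +1`), `M` odd, `D ∣ M`, `c` prime to `2M`,
  **`G⁺(0) = 0`, `T ∣ ½G⁺` in `Λ`** — because `B_{1, ε·𝟙_odd} = (1 − ε(2))·B_{1,ε} = 0`
  (`bernoulliOne_oddRestrict_eq`, the `k = 1` distribution relation of `B₁(X) = X − ½` across `ℤ/M → ℤ/2M`);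
  hence `λ(½G⁺) ≥ 1` whenever `½G⁺ ≠ 0` (`one_le_lam_half_quadTwoNumerator`).  This is the `2`-adic
  Ferrero–Greenberg trivial zero of `L₂(s, ε_Kω)` at `s = 0` («the trivial-character exceptional zero at 2
  booked as an explicit λ-shift», pen RC-351 (3)) — PROVED here at the level of the numerator, so that on the
  cyclotomic line `λ(L^{Katz}_{2,cyc}) = [λ(½G⁺) − λ(h_c)] + [λ(½G⁰) − λ(1 − 5(1+T))] = (λ(g⁺) ) + (−1)` is a
  sum of kernel / named integers (`λ(½G⁰_{1,5}) = 0`: `…GL1CycLineKLTriv.lam_halfLift_klTwoNumerator`).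

Dictionary for the consumer (v5 stubs 6b / B3a of the line; nothing of it is asserted here): `K` imaginary
quadratic with the Heegner hypothesis for `2N` has `d_K ≡ 1 (mod 8)`, `D = |d_K| ≡ 7 (mod 8)`, and
`ε_K(n) = (d_K/n) = (n|D)` for `n` odd (quadratic reciprocity, `D ≡ 3 (4)`); the analytic GL(1) `λ` of the
`S`-depleted cyclotomic line is `λ(½·quadTwoNumerator D (D∏S) c) − 1 + λ(½·trivTwoNumerator (∏S) c) − 1 − …`
with the regulariser shifts `λ(h_c)` named in the companion file's module docstring.

No `sorry`, no named fact, no instance, no notation; axioms ⊆ {propext, Classical.choice, Quot.sound}.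

References: [LangCyclotomic1990] Ch. 2 §2 (B 1–B 7, E_{1,c}, Thm. 2.4), Ch. 4 §3 Thm. 3.2; [Washington1997] §4
(generalized Bernoulli numbers of imprimitive characters), §7.2; [Gross1980Factorization] Invent. Math. 57 (1980)
83–95; [Kriz2016] Algebra Number Theory 10 (2016) Thm. 28; [KrizLi2019] Forum Math. Sigma 7 (2019) e15, Lemma 7.6;
[FerreroGreenberg1978] B. Ferrero, R. Greenberg, Invent. Math. 50 (1978) 91–102 (the trivial zero at s = 0).
-/

noncomputable section

open scoped Classical

open Filter Topology Finset
open Literature.NumberTheory.EllipticCurves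
open Summit.BirchSwinnertonDyer.Rank1Residual.X1.MuLambda (lam)

set_option autoImplicit false
set_option linter.dupNamespace false

namespace Summit.BirchSwinnertonDyer.BirchSwinnertonDyer.Theorems.TwoAdicGL1CycLine

/-! ## §1 A distribution-relation identity for `B₁`: restricting a character to the odd integers multiplies
`B_{1,χ}` by `1 − χ(2)` -/

section BernoulliOne

/-- Splitting `∑_{i<2M}` into even and odd indices. [folklore] -/
private theorem sum_range_two_mul {R : Type*} [AddCommMonoid R] (f : ℕ → R) (M : ℕ) :
    ∑ i ∈ Finset.range (2 * M), f i =
      ∑ j ∈ Finset.range M, f (2 * j) + ∑ j ∈ Finset.range M, f (2 * j + 1) := by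
  induction M with
  | zero => simp
  | succ M ih =>
      rw [show 2 * (M + 1) = 2 * M + 1 + 1 by ring, Finset.sum_range_succ, Finset.sum_range_succ, ih,
        Finset.sum_range_succ, Finset.sum_range_succ]
      abel

/-- **`B_{1, χ·𝟙_odd} = (1 − χ(2))·B_{1,χ}`** for an `M`-periodic `χ` multiplicative at `2` (the `k = 1` case of the
Euler-factor relation between the generalized Bernoulli numbers of a character and of its restriction to the
integers prime to `2`; `B₁(X) = X − ½`): with `B₁(x/2) + B₁((x+1)/2) = B₁(x)` (Lang **B 3**, distribution
relation) one gets `∑_{i<2M} χ(i)B₁(i/2M) = ∑_{i<M} χ(i)B₁(i/M)`, and the even indices contribute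
`χ(2)·∑_{j<M} χ(j)B₁(j/M)`. [cite: LangCyclotomic1990, Ch. 2 §2, B 3 and B 7 (PDF pp. 34–35)]
[cite: Washington1997, §4 (B_{1,χ} of an imprimitive character, proof of Thm. 4.2)] -/
theorem bernoulliOne_oddRestrict_eq {M : ℕ} (hM : M ≠ 0) (χ : ℕ → ℚ_[2]) (hper : ∀ i, χ (i + M) = χ i)
    (h2 : ∀ i, χ (2 * i) = χ 2 * χ i) :
    ∑ i ∈ Finset.range (2 * M), (if 2 ∣ i then 0 else χ i) * ((i : ℚ_[2]) / ((2 * M : ℕ) : ℚ_[2]) - 2⁻¹) =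
      (1 - χ 2) * ∑ i ∈ Finset.range M, χ i * ((i : ℚ_[2]) / (M : ℚ_[2]) - 2⁻¹) := by
  have hM' : (M : ℚ_[2]) ≠ 0 := by exact_mod_cast hM
  -- the full sum over `ℤ/2M` equals `B_{1,χ}` (distribution relation for `B₁`)
  have hfull : ∑ i ∈ Finset.range (2 * M), χ i * ((i : ℚ_[2]) / ((2 * M : ℕ) : ℚ_[2]) - 2⁻¹) =
      ∑ i ∈ Finset.range M, χ i * ((i : ℚ_[2]) / (M : ℚ_[2]) - 2⁻¹) := by
    rw [two_mul, Finset.sum_range_add, ← Finset.sum_add_distrib]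
    refine Finset.sum_congr rfl fun i _ ↦ ?_
    rw [add_comm M i, hper i]
    push_cast
    field_simp
    ring
  -- the even indices contribute `χ(2)·B_{1,χ}`
  have heven : ∑ j ∈ Finset.range M,
      χ (2 * j) * ((((2 * j : ℕ)) : ℚ_[2]) / ((2 * M : ℕ) : ℚ_[2]) - 2⁻¹) =
      χ 2 * ∑ i ∈ Finset.range M, χ i * ((i : ℚ_[2]) / (M : ℚ_[2]) - 2⁻¹) := by
    rw [Finset.mul_sum]
    refine Finset.sum_congr rfl fun j _ ↦ ?_
    rw [h2 j]
    push_cast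
    rw [mul_div_mul_left _ _ (two_ne_zero' ℚ_[2])]
    ring
  -- split the restricted sum and the full sum into even and odd indices
  rw [sum_range_two_mul] at hfull ⊢
  have hE : ∑ j ∈ Finset.range M, (if 2 ∣ 2 * j then 0 else χ (2 * j)) *
      ((((2 * j : ℕ)) : ℚ_[2]) / ((2 * M : ℕ) : ℚ_[2]) - 2⁻¹) = 0 :=
    Finset.sum_eq_zero fun j _ ↦ by rw [if_pos (dvd_mul_right 2 j), zero_mul]
  have hO : ∑ j ∈ Finset.range M, (if 2 ∣ 2 * j + 1 then 0 else χ (2 * j + 1)) *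
      ((((2 * j + 1 : ℕ)) : ℚ_[2]) / ((2 * M : ℕ) : ℚ_[2]) - 2⁻¹) =
      ∑ j ∈ Finset.range M, χ (2 * j + 1) *
        ((((2 * j + 1 : ℕ)) : ℚ_[2]) / ((2 * M : ℕ) : ℚ_[2]) - 2⁻¹) :=
    Finset.sum_congr rfl fun j _ ↦ by rw [if_neg (by omega)]
  rw [hE, hO, zero_add]
  rw [heven] at hfull
  linear_combination hfull

end BernoulliOne

/-! ## §2 The depleted odd quadratic character `ε_D·𝟙_{(·,2M)=1}` on `ℤ/2M` and the numerator `G⁺` -/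

section Quad

/-- **`θ⁺_{D,M} : ℤ/2M → ℤ₂`, `x ↦ (x|D)` on the units and `0` elsewhere** — the odd quadratic character
`ε_D = (·|D)` (Jacobi symbol; for `D ≡ 3 (mod 4)` squarefree it is the character `(−D/·)` of `ℚ(√−D)` by
quadratic reciprocity) restricted to the classes prime to `2M`, i.e. `ε_D · 𝟙_odd` DEPLETED at the odd primes
dividing `M` (Lang Ch. 2 §2: a character "extended by `0`"; Greenberg–Vatsal's `Σ₀`-imprimitive characters).
The `θ = χω⁻¹` of the Kubota–Leopoldt measure for `χ = ε_Dω = ε_D·χ₋₄` (EVEN).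
[cite: LangCyclotomic1990, Ch. 2 §2 (characters on Z(N)^* extended by 0, PDF p. 36) and Ch. 4 §3 (θ = χω⁻¹, PDF p. 84)] -/
def quadOddChar (D M : ℕ) : ZMod (2 * M) → ℤ_[2] :=
  fun x ↦ if IsUnit x then ((jacobiSym (x.val : ℤ) D : ℤ) : ℤ_[2]) else 0

/-- **`G⁺_{D,M,c}(T) = ∫_{ℤ₂^×}(1+T)^{ℓ(x)} d(θ⁺_{D,M}E_{1,c})(x)`** — the `2`-adic Kubota–Leopoldt numerator of the
`M`-depleted EVEN character `ε_Dω` (Lang Ch. 4 §3 Thm. 3.2, PRINT: `G⁺(5^s − 1) = −(1 − ε_Dω(c)⟨c⟩^{s+1})·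
L₂^{(M)}(−s, ε_Dω)`); the first Kubota–Leopoldt factor of Gross's factorisation on the cyclotomic line at `2`.
[cite: LangCyclotomic1990, Ch. 4 §3 Thm. 3.2 (PDF p. 84)] [cite: Gross1980Factorization, main theorem (χ = 1)] -/
def quadTwoNumerator (D M c : ℕ) [NeZero M] : PowerSeries ℚ_[2] :=
  twoKLNumerator (quadOddChar D M) c

variable {D M : ℕ} [NeZero M]

omit [NeZero M] in
/-- `θ⁺` on the integers: `(b|D)` if `b` is prime to `2M`, else `0`.
[cite: LangCyclotomic1990, Ch. 2 §2 (characters extended by 0, PDF p. 36)] -/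
theorem quadOddChar_natCast (hDM : D ∣ 2 * M) (b : ℕ) :
    quadOddChar D M (b : ZMod (2 * M)) =
      if b.Coprime (2 * M) then ((jacobiSym (b : ℤ) D : ℤ) : ℤ_[2]) else 0 := by
  unfold quadOddChar
  by_cases h : b.Coprime (2 * M)
  · rw [if_pos ((ZMod.isUnit_iff_coprime b (2 * M)).mpr h), if_pos h]
    congr 1
    apply jacobiSym.mod_left'
    rw [ZMod.val_natCast]
    push_cast
    exact Int.emod_emod_of_dvd _ (by exact_mod_cast hDM)
  · rw [if_neg (fun hu ↦ h ((ZMod.isUnit_iff_coprime b (2 * M)).mp hu)), if_neg h]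

omit [NeZero M] in
/-- `θ⁺` vanishes off the units, in particular on the even integers. [cite: LangCyclotomic1990, Ch. 2 §2 (PDF p. 36)] -/
theorem quadOddChar_natCast_of_two_dvd (b : ℕ) (hb : 2 ∣ b) : quadOddChar D M (b : ZMod (2 * M)) = 0 := by
  unfold quadOddChar
  rw [if_neg]
  intro hu
  have h := (ZMod.isUnit_iff_coprime b (2 * M)).mp hu
  have h2 : Nat.Coprime 2 (2 * M) := Nat.Coprime.coprime_dvd_left hb h
  have h22 : Nat.Coprime 2 2 := Nat.Coprime.coprime_mul_right_right h2
  norm_num at h22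

omit [NeZero M] in
/-- `θ⁺` is multiplicative with respect to every `c`: `θ⁺(c·x) = θ⁺(c)θ⁺(x)` on the integers.
[cite: LangCyclotomic1990, Ch. 2 §2 (Dirichlet characters, PDF p. 36)] -/
theorem quadOddChar_natCast_mul (hDM : D ∣ 2 * M) (c x : ℕ) :
    quadOddChar D M ((c * x : ℕ) : ZMod (2 * M)) =
      quadOddChar D M (c : ZMod (2 * M)) * quadOddChar D M (x : ZMod (2 * M)) := by
  rw [quadOddChar_natCast hDM, quadOddChar_natCast hDM, quadOddChar_natCast hDM]
  by_cases hc : c.Coprime (2 * M)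
  · by_cases hx : x.Coprime (2 * M)
    · rw [if_pos (Nat.Coprime.mul_left hc hx), if_pos hc, if_pos hx]
      push_cast
      rw [jacobiSym.mul_left]
      push_cast
      ring
    · rw [if_neg (fun h ↦ hx (Nat.Coprime.coprime_mul_left h)), if_neg hx, mul_zero]
  · rw [if_neg (fun h ↦ hc (Nat.Coprime.coprime_mul_right h)), if_neg hc, zero_mul]

/-- `θ⁺` is ODD for `D ≡ 3 (mod 4)`: `θ⁺(−x) = −θ⁺(x)` (`(−1|D) = χ₄(D) = −1`).
[cite: LangCyclotomic1990, Ch. 2 §2 (odd characters, PDF p. 36)] -/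
theorem quadOddChar_neg (hDM : D ∣ 2 * M) (hD : D % 4 = 3) (x : ZMod (2 * M)) :
    quadOddChar D M (-x) = -quadOddChar D M x := by
  have hDodd : Odd D := Nat.odd_iff.mpr (by omega)
  unfold quadOddChar
  by_cases hx : IsUnit x
  · rw [if_pos hx.neg, if_pos hx]
    have hmod : (((-x).val : ℕ) : ℤ) % (D : ℕ) = (-((x.val : ℕ) : ℤ)) % (D : ℕ) := by
      have h1 : ((((-x).val : ℕ) : ℤ) : ZMod D) = (((-((x.val : ℕ) : ℤ)) : ℤ) : ZMod D) := by
        have h2 : (((-x).val : ℕ) : ZMod D) = -((x.val : ℕ) : ZMod D) := by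
          rw [← ZMod.cast_eq_val, ← ZMod.cast_eq_val, ← ZMod.castHom_apply (h := hDM),
            ← ZMod.castHom_apply (h := hDM), map_neg]
        push_cast
        exact_mod_cast h2
      exact (ZMod.intCast_eq_intCast_iff' _ _ _).mp h1
    rw [jacobiSym.mod_left' hmod, neg_eq_neg_one_mul (((x.val : ℕ) : ℤ)), jacobiSym.mul_left,
      jacobiSym.at_neg_one hDodd]
    have hχ : ZMod.χ₄ (D : ZMod 4) = -1 := by
      rw [ZMod.χ₄_nat_eq_if_mod_four, if_neg (by omega), if_neg (by omega)]
    rw [hχ]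
    push_cast
    ring
  · have hnx : ¬ IsUnit (-x) := fun h ↦ hx (neg_neg x ▸ h.neg)
    rw [if_neg hnx, if_neg hx, neg_zero]

omit [NeZero M] in
/-- `c` prime to `2M` is prime to the level `2M · 2`. [folklore] -/
private theorem coprime_level {c : ℕ} (hc : c.Coprime (2 * M)) : c.Coprime (2 * M * 2) :=
  Nat.Coprime.mul_right hc (Nat.Coprime.coprime_mul_right_right hc)

/-- **`½G⁺ ∈ Λ`**: `‖[T^k]G⁺‖₂ ≤ ½` for `D ≡ 3 (mod 4)`, `D ∣ 2M`, `c` prime to `2M` (`θ⁺` is odd, the measure is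
even, the `±1`-halves of the Riemann sums agree). [cite: MazurTateTeitelbaum1986Invent, §I.12–I.13 (p = 2)] -/
theorem norm_coeff_quadTwoNumerator_le_half (hDM : D ∣ 2 * M) (hD : D % 4 = 3) {c : ℕ}
    (hc : c.Coprime (2 * M)) (k : ℕ) : ‖PowerSeries.coeff k (quadTwoNumerator D M c)‖ ≤ 2⁻¹ :=
  norm_coeff_twoKLNumerator_le_half (coprime_level hc) (quadOddChar_neg hDM hD) k

/-- **`G⁺(0) = (1 − (c|D)·c)·B_{1,θ⁺}`** (total mass of `θ⁺E_{1,c}`).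
[cite: LangCyclotomic1990, Ch. 2 §2 Thm. 2.4 (PDF p. 38)] [cite: MazurTateTeitelbaum1986Invent, §I.13] -/
theorem constantCoeff_quadTwoNumerator_eq (hDM : D ∣ 2 * M) {c : ℕ} (hc : c.Coprime (2 * M)) :
    PowerSeries.constantCoeff (quadTwoNumerator D M c) =
      (1 - ((quadOddChar D M (c : ZMod (2 * M)) : ℤ_[2]) : ℚ_[2]) * (c : ℚ_[2])) *
        bernoulliOne (quadOddChar D M) :=
  constantCoeff_twoKLNumerator_eq (coprime_level hc) (quadOddChar_natCast_of_two_dvd)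
    (quadOddChar_natCast_mul hDM c)

/-- **The trivial zero, Bernoulli form: `B_{1,θ⁺_{D,M}} = 0` for `D ≡ ±1 (mod 8)`** (`(2|D) = χ₈(D) = 1`: the
prime `2` SPLITS in `ℚ(√−D)` when `D ≡ 7 (8)`), `M` odd, `D ∣ M`: `B_{1, ε·𝟙_odd} = (1 − ε(2))B_{1,ε} = 0` with
`ε = (·|D)·𝟙_{(·,M)=1}`. [cite: LangCyclotomic1990, Ch. 2 §2, B 3 / B 7 (PDF pp. 34–35)]
[cite: Washington1997, §4 (B_{1,χ} for imprimitive χ)] -/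
theorem bernoulliOne_quadOddChar_eq_zero (hDM : D ∣ M) (hM : Odd M) (hD : D % 8 = 7 ∨ D % 8 = 1) :
    bernoulliOne (quadOddChar D M) = 0 := by
  have hM0 : M ≠ 0 := Nat.ne_of_odd_add ((add_zero M).symm ▸ hM) |>.symm |> fun h ↦ by
    rintro rfl; exact (Nat.not_odd_zero hM).elim
  have hDM' : D ∣ 2 * M := dvd_mul_of_dvd_right hDM 2
  have hDodd : Odd D := by rcases hD with h | h <;> exact Nat.odd_iff.mpr (by omega)
  -- the character `ε = (·|D)·𝟙_{(·,M)=1}` read in `ℚ₂`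
  set χ : ℕ → ℚ_[2] := fun i ↦ if i.Coprime M then ((jacobiSym (i : ℤ) D : ℤ) : ℚ_[2]) else 0 with hχ
  have hθ : ∀ i : ℕ, ((quadOddChar D M (i : ZMod (2 * M)) : ℤ_[2]) : ℚ_[2]) =
      if 2 ∣ i then 0 else χ i := by
    intro i
    rw [quadOddChar_natCast hDM']
    by_cases h2 : 2 ∣ i
    · rw [if_pos h2, if_neg]
      · simp
      · intro h
        have := Nat.Coprime.coprime_mul_right_right (Nat.Coprime.coprime_dvd_left h2 h)
        simp at this
    · rw [if_neg h2, hχ]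
      simp only
      have hi2 : i.Coprime 2 := Nat.coprime_two_right.mpr (Nat.odd_iff.mpr (by omega))
      by_cases hiM : i.Coprime M
      · rw [if_pos (Nat.Coprime.mul_right hi2 hiM), if_pos hiM]; push_cast; rfl
      · rw [if_neg (fun h ↦ hiM (Nat.Coprime.coprime_mul_left_right h)), if_neg hiM]; simp
  have hper : ∀ i, χ (i + M) = χ i := by
    intro i
    simp only [hχ]
    have hc : (i + M).Coprime M ↔ i.Coprime M := by
      rw [Nat.Coprime, Nat.Coprime, Nat.gcd_comm, Nat.gcd_add_self_right, Nat.gcd_comm]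
    have hmod : ((i + M : ℕ) : ℤ) % (D : ℕ) = (i : ℤ) % (D : ℕ) := by
      obtain ⟨q, hq⟩ := hDM
      rw [hq]
      push_cast
      exact Int.add_mul_emod_self_left _ _ _
    rw [jacobiSym.mod_left' hmod]
    simp only [hc]
  have h2χ : χ 2 = 1 := by
    simp only [hχ]
    rw [if_pos (Nat.coprime_two_left.mpr hM)]
    push_cast
    rw [jacobiSym.at_two hDodd]
    rcases hD with h | h
    · rw [ZMod.χ₈_nat_eq_if_mod_eight, if_neg (by omega), if_pos (by omega)]; simp
    · rw [ZMod.χ₈_nat_eq_if_mod_eight, if_neg (by omega), if_pos (by omega)]; simp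
  have hmul2 : ∀ i, χ (2 * i) = χ 2 * χ i := by
    intro i
    rw [h2χ, one_mul]
    simp only [hχ]
    have hc : (2 * i).Coprime M ↔ i.Coprime M :=
      ⟨fun h ↦ Nat.Coprime.coprime_mul_left h, fun h ↦ Nat.Coprime.mul_left (Nat.coprime_two_left.mpr hM) h⟩
    by_cases hi : i.Coprime M
    · rw [if_pos (hc.mpr hi), if_pos hi]
      push_cast
      rw [jacobiSym.mul_left, jacobiSym.at_two hDodd]
      rcases hD with h | h
      · rw [ZMod.χ₈_nat_eq_if_mod_eight, if_neg (by omega), if_pos (by omega)]; simp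
      · rw [ZMod.χ₈_nat_eq_if_mod_eight, if_neg (by omega), if_pos (by omega)]; simp
    · rw [if_neg (fun h ↦ hi (hc.mp h)), if_neg hi]
  -- `B_{1,θ⁺} = (1 − χ(2))·B_{1,χ} = 0`
  unfold bernoulliOne
  have hsum : ∑ i ∈ Finset.range (2 * M), ((quadOddChar D M (i : ZMod (2 * M)) : ℤ_[2]) : ℚ_[2]) *
      (((Polynomial.bernoulli 1).eval ((i : ℚ) / (2 * M : ℕ)) : ℚ) : ℚ_[2]) =
      ∑ i ∈ Finset.range (2 * M), (if 2 ∣ i then 0 else χ i) *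
        ((i : ℚ_[2]) / ((2 * M : ℕ) : ℚ_[2]) - 2⁻¹) := by
    refine Finset.sum_congr rfl fun i _ ↦ ?_
    rw [hθ i, Polynomial.bernoulli_one]
    simp only [Polynomial.eval_sub, Polynomial.eval_X, Polynomial.eval_C]
    push_cast
    ring
  rw [hsum, bernoulliOne_oddRestrict_eq hM0 χ hper hmul2, h2χ, sub_self, zero_mul]

/-- **TRIVIAL ZERO at `2`: `G⁺_{D,M,c}(0) = 0`** for `D ≡ 7 (mod 8)`, `M` odd with `D ∣ M`, `c` prime to `2M` —
the numerator of the `2`-adic `L`-function of the even character `ε_Kω` of the Greenberg field `K = ℚ(√−D)`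
vanishes at the trivial character because `2` splits in `K` (`ε_K(2) = +1` kills the Euler factor
`1 − ε_Kω·ω⁻¹(2)` of `L₂(0, ε_Kω) = −(1 − ε_K(2))B_{1,ε_K}`; Ferrero–Greenberg).
[cite: FerreroGreenberg1978, §1 (trivial zero of L_p(s,χ) at s = 0 when χω⁻¹(p) = 1)]
[cite: LangCyclotomic1990, Ch. 4 §3 Thm. 3.2 (PDF p. 84)] -/
theorem constantCoeff_quadTwoNumerator_eq_zero (hDM : D ∣ M) (hM : Odd M) (hD : D % 8 = 7) {c : ℕ}
    (hc : c.Coprime (2 * M)) : PowerSeries.constantCoeff (quadTwoNumerator D M c) = 0 := by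
  rw [constantCoeff_quadTwoNumerator_eq (dvd_mul_of_dvd_right hDM 2) hc,
    bernoulliOne_quadOddChar_eq_zero hDM hM (Or.inl hD), mul_zero]

/-- **`T ∣ G⁺` in `ℚ₂⟦T⟧`** (trivial zero). [cite: FerreroGreenberg1978, §1] [cite: LangCyclotomic1990, Ch. 4 §3 Thm. 3.2] -/
theorem X_dvd_quadTwoNumerator (hDM : D ∣ M) (hM : Odd M) (hD : D % 8 = 7) {c : ℕ}
    (hc : c.Coprime (2 * M)) : (PowerSeries.X : PowerSeries ℚ_[2]) ∣ quadTwoNumerator D M c :=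
  PowerSeries.X_dvd_iff.mpr (constantCoeff_quadTwoNumerator_eq_zero hDM hM hD hc)

/-- `D ≡ 7 (mod 8)` implies `D ≡ 3 (mod 4)`. [folklore] -/
private theorem mod_four_of_mod_eight (hD : D % 8 = 7) : D % 4 = 3 := by omega

/-- **`T ∣ ½G⁺` in `Λ = ℤ₂⟦T⟧`** (the trivial zero on the integral half-lift).
[cite: FerreroGreenberg1978, §1] [cite: Washington1997, §7.2 (p = 2)] -/
theorem X_dvd_half_quadTwoNumerator (hDM : D ∣ M) (hM : Odd M) (hD : D % 8 = 7) {c : ℕ}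
    (hc : c.Coprime (2 * M)) :
    (PowerSeries.X : IwasawaAlgebra 2) ∣
      halfLift (quadTwoNumerator D M c)
        (norm_coeff_quadTwoNumerator_le_half (dvd_mul_of_dvd_right hDM 2) (mod_four_of_mod_eight hD) hc) :=
  (X_dvd_halfLift_iff _).mpr (constantCoeff_quadTwoNumerator_eq_zero hDM hM hD hc)

/-- **The trivial-zero `λ`-shift: `λ(½G⁺) ≥ 1`** whenever `½G⁺ ≠ 0`.
[cite: FerreroGreenberg1978, §1] [cite: Washington1997, §7.1–§7.2] -/
theorem one_le_lam_half_quadTwoNumerator (hDM : D ∣ M) (hM : Odd M) (hD : D % 8 = 7) {c : ℕ}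
    (hc : c.Coprime (2 * M))
    (hne : halfLift (quadTwoNumerator D M c)
      (norm_coeff_quadTwoNumerator_le_half (dvd_mul_of_dvd_right hDM 2) (mod_four_of_mod_eight hD) hc) ≠ 0) :
    1 ≤ lam (halfLift (quadTwoNumerator D M c)
      (norm_coeff_quadTwoNumerator_le_half (dvd_mul_of_dvd_right hDM 2) (mod_four_of_mod_eight hD) hc)) :=
  one_le_lam_of_X_dvd hne (X_dvd_half_quadTwoNumerator hDM hM hD hc)

end Quad


/-! ## §3 The Greenberg field: `|d_K| ≡ 7 (mod 8)`, so the trivial zero applies with `D = |d_K|` -/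

section GreenbergField

/-- **A Greenberg field has `|d_K| ≡ 7 (mod 8)`**: `K` imaginary quadratic with the Heegner hypothesis for `2N`
has `d_K < 0` and `d_K ≡ 1 (mod 8)` (`2` splits; tree `TwoAdicGreenbergTwist.discr_emod_eight_of_greenbergField`).
[cite: Washington1997, §13.1 (p. 264)] -/
theorem natAbs_discr_mod_eight_of_greenbergField {N : ℕ} {K : Type} [Field K] [NumberField K]
    (hK : IsImaginaryQuadratic K) (hH : SatisfiesHeegnerHypothesis (2 * N) K) :
    (NumberField.discr K).natAbs % 8 = 7 := by
  have h1 := TwoAdicGreenbergTwist.discr_emod_eight_of_greenbergField hK hH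
  have hneg := hK.discr_neg
  have habs : ((NumberField.discr K).natAbs : ℤ) = -NumberField.discr K :=
    Int.ofNat_natAbs_of_nonpos hneg.le
  omega

/-- **The trivial zero for a Greenberg field.**  For `K` imaginary quadratic with the Heegner hypothesis for `2N`,
`D := |d_K|`, every odd modulus `M` with `D ∣ M` (for the line: `M = D·∏_{ℓ∈S} ℓ`) and every `c` prime to `2M`:
the integral half of the `M`-depleted `2`-adic Kubota–Leopoldt numerator of `ε_Kω` is divisible by `T` in `Λ`,
`T ∣ ½G⁺_{D,M,c}` — the exceptional zero of `L₂(s, ε_Kω)` at `s = 0` forced by the splitting of `2` in `K`.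
[cite: FerreroGreenberg1978, §1] [cite: Gross1980Factorization, main theorem (χ = 1: the factor L_p(ε_Kω, s))] -/
theorem X_dvd_half_quadTwoNumerator_of_greenbergField {N : ℕ} {K : Type} [Field K] [NumberField K]
    (hK : IsImaginaryQuadratic K) (hH : SatisfiesHeegnerHypothesis (2 * N) K)
    {M : ℕ} [NeZero M] (hDM : (NumberField.discr K).natAbs ∣ M) (hM : Odd M) {c : ℕ}
    (hc : c.Coprime (2 * M)) :
    (PowerSeries.X : IwasawaAlgebra 2) ∣
      halfLift (quadTwoNumerator (NumberField.discr K).natAbs M c)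
        (norm_coeff_quadTwoNumerator_le_half (dvd_mul_of_dvd_right hDM 2)
          (by have := natAbs_discr_mod_eight_of_greenbergField hK hH; omega) hc) :=
  X_dvd_half_quadTwoNumerator hDM hM (natAbs_discr_mod_eight_of_greenbergField hK hH) hc

end GreenbergField

end Summit.BirchSwinnertonDyer.BirchSwinnertonDyer.Theorems.TwoAdicGL1CycLine

end
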